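import Literature.AlgebraicGeometry.Motives.MixedHodgeStructureKrullSchmidtUniqueness
import Literature.AlgebraicGeometry.Motives.MixedHodgeStructureIndecomposableDual
import HarnessLib

/-!
# Consequences of the Krull–Schmidt theorem for mixed Hodge structures: multiplicities and cancellation

Sequel of `MixedHodgeStructureKrullSchmidtUniqueness` (Lam's Krull–Schmidt–Azumaya theorem (19.21) for the abelian
category of mixed Hodge structures, Cattani–El Zein–Griffiths–Lê Thm. 3.2.18). Namespace `MixedHodgeStructure`;
everything proved, no named facts:

* §1 decompositions are transported along isomorphisms `H ⥲ H'` (`isIndecomposable_map_of_injective`,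
  `krullSchmidt_of_bijective`: the indecomposable summands of isomorphic MHS correspond);
* §2 **multiplicities are invariants** (Lam (19.22): "the sequence of isomorphism types … is uniquely determined up
  to a permutation"): the number of summands isomorphic to a given `K` is the same in any two decompositions, also of
  two isomorphic MHS (`card_filter_iso_eq`, `card_filter_iso_eq_of_bijective`);
* §3 **assembly**: summand-wise isomorphisms `Sᵢ ≅ T_{τ i}` along a bijection `τ` of the index sets glue to an
  isomorphism `⊕ᵢ Sᵢ ≅ ⊕ₖ Tₖ` (`exists_hom_bijective_of_forall_iso`);
* §4 the decomposition of a direct sum `H ⊕ K` obtained from a decomposition of `H` and the axis `0 ⊕ K`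
  (`iSupIndep_optionElim`, …);
* §5 **cancellation**: `H₁ ⊕ K ≅ H₂ ⊕ K ⇒ H₁ ≅ H₂`, first for `K` indecomposable
  (`exists_hom_bijective_of_prod_of_isIndecomposable`, via Krull–Schmidt and `Equiv.removeNone`), then for every
  `K` by induction on `dim K` (**`exists_hom_bijective_of_prod`**). Lam (20.11) (Evans) / Facchini Cor. 4.6 prove
  cancellation for a summand with semilocal endomorphism ring via stable range; for MHS (finite length, local
  endomorphism rings of indecomposables) we take the shorter road through the tree's Krull–Schmidt theorem.

## References

* [Lam2001FirstCourse] T. Y. Lam, A First Course in Noncommutative Rings, 2nd ed. (2001), Thm. (19.21), Cor. (19.22)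
  (pp. 287–288); Cancellation Theorem (20.11) (Evans), p. 299.
* [CattaniElZeinGriffithsLe2014] E. Cattani et al. (eds.), Hodge Theory (2014), Thm. 3.2.18, Lemma 3.2.20, p. 270.
-/

noncomputable section

namespace Literature.AlgebraicGeometry.Motives

namespace MixedHodgeStructure

universe u v w u'

variable {V : Type u} [AddCommGroup V] [Module ℚ V]
variable {V' : Type v} [AddCommGroup V'] [Module ℚ V']
variable {H : MixedHodgeStructure V} {H' : MixedHodgeStructure V'}

open Module SubMixedHodgeStructure

/-! ### §0 Isomorphism bookkeeping -/

/-- The composite of bijective morphisms is bijective. [folklore] -/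
private theorem bij_comp {V₂ : Type w} [AddCommGroup V₂] [Module ℚ V₂] {H₂ : MixedHodgeStructure V₂}
    {V₃ : Type u'} [AddCommGroup V₃] [Module ℚ V₃] {H₃ : MixedHodgeStructure V₃} (g : Hom H₂ H₃) (f : Hom H H₂)
    (hg : Function.Bijective g.toLinearMap) (hf : Function.Bijective f.toLinearMap) :
    Function.Bijective (g.comp f).toLinearMap := by
  rw [Hom.comp_toLinearMap, LinearMap.coe_comp]
  exact hg.comp hf

/-- The inverse of a bijective morphism is bijective. [folklore] -/
private theorem bij_inverse (f : Hom H H') (hf : Function.Bijective f.toLinearMap) :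
    Function.Bijective (f.inverse hf).toLinearMap := by
  rw [Hom.inverse_toLinearMap]
  exact (LinearEquiv.ofBijective f.toLinearMap hf).symm.bijective

/-- "Isomorphic" is symmetric. [folklore] -/
private theorem iso_symm (h : ∃ e : Hom H H', Function.Bijective e.toLinearMap) :
    ∃ e : Hom H' H, Function.Bijective e.toLinearMap := by
  obtain ⟨e, he⟩ := h
  exact ⟨e.inverse he, bij_inverse e he⟩

/-- "Isomorphic" is transitive. [folklore] -/
private theorem iso_trans {V₂ : Type w} [AddCommGroup V₂] [Module ℚ V₂] {H₂ : MixedHodgeStructure V₂}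
    (h₁ : ∃ e : Hom H H', Function.Bijective e.toLinearMap) (h₂ : ∃ e : Hom H' H₂, Function.Bijective e.toLinearMap) :
    ∃ e : Hom H H₂, Function.Bijective e.toLinearMap := by
  obtain ⟨e₁, he₁⟩ := h₁
  obtain ⟨e₂, he₂⟩ := h₂
  exact ⟨e₂.comp e₁, bij_comp e₂ e₁ he₂ he₁⟩

/-- A finite sum of morphisms `H → H'` is (the underlying map of) a morphism. [cite: CattaniElZeinGriffithsLe2014, Thm. 3.2.18] -/
theorem Hom.exists_toLinearMap_eq_sum' {ι : Type w} (s : Finset ι) (f : ι → Hom H H') :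
    ∃ F : Hom H H', F.toLinearMap = ∑ i ∈ s, (f i).toLinearMap := by
  classical
  induction s using Finset.induction_on with
  | empty => exact ⟨Hom.zero H H', by rw [Finset.sum_empty]; rfl⟩
  | insert i s hi ih =>
    obtain ⟨F, hF⟩ := ih
    exact ⟨(f i).add F, by rw [Finset.sum_insert hi, Hom.add_toLinearMap, hF]⟩

/-! ### §1 Transport of a decomposition along an isomorphism -/

/-- The image of an indecomposable sub-MHS under an injective morphism is indecomposable.
[cite: Lam2001FirstCourse, Thm. (19.21), p. 287] -/
theorem isIndecomposable_map_of_injective (f : Hom H H') (hf : Function.Injective f.toLinearMap)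
    {S : SubMixedHodgeStructure H} (hS : S.toMixedHodgeStructure.IsIndecomposable) :
    (S.map f).toMixedHodgeStructure.IsIndecomposable :=
  hS.of_bijective _ (bijective_restrictHom_map f hf S)

variable [FiniteDimensional ℚ V] [FiniteDimensional ℚ V']

omit [FiniteDimensional ℚ V] in
/-- **Krull–Schmidt across an isomorphism**: if `f : H ⥲ H'` and `H = ⊕ᵢ Sᵢ`, `H' = ⊕ₖ Tₖ` are decompositions into
indecomposable sub-MHS, there is a bijection `σ` with `Sᵢ ≅ T_{σ i}`. [cite: Lam2001FirstCourse, Thm. (19.21), pp. 287–288] -/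
theorem krullSchmidt_of_bijective {ι : Type w} {κ : Type u'} [Fintype ι] [Fintype κ] (f : Hom H H')
    (hf : Function.Bijective f.toLinearMap) (S : ι → SubMixedHodgeStructure H) (T : κ → SubMixedHodgeStructure H')
    (hS : iSupIndep fun i => (S i).toSubmodule) (hS' : (⨆ i, (S i).toSubmodule) = ⊤)
    (hSi : ∀ i, (S i).toMixedHodgeStructure.IsIndecomposable)
    (hT : iSupIndep fun k => (T k).toSubmodule) (hT' : (⨆ k, (T k).toSubmodule) = ⊤)
    (hTi : ∀ k, (T k).toMixedHodgeStructure.IsIndecomposable) :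
    ∃ σ : ι ≃ κ, ∀ i, ∃ e : Hom (S i).toMixedHodgeStructure (T (σ i)).toMixedHodgeStructure,
      Function.Bijective e.toLinearMap := by
  obtain ⟨σ, hσ⟩ := krullSchmidt_fintype (fun i => (S i).map f) T (iSupIndep_map_of_injective f hf.1 hS)
    (iSup_map_eq_top_of_surjective f hf.2 hS') (fun i => isIndecomposable_map_of_injective f hf.1 (hSi i)) hT hT' hTi
  refine ⟨σ, fun i => iso_trans ⟨_, bijective_restrictHom_map f hf.1 (S i)⟩ (hσ i)⟩

/-! ### §2 Multiplicities of indecomposable summands -/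

open scoped Classical in
/-- **The multiplicity of an isomorphism type is an invariant** (Lam (19.22): the isomorphism types of the
indecomposable summands are determined up to permutation): for any MHS `K`, the number of summands isomorphic to
`K` is the same in any two decompositions of `H` into indecomposables. [cite: Lam2001FirstCourse, Cor. (19.22), p. 288] -/
theorem card_filter_iso_eq {VK : Type u'} [AddCommGroup VK] [Module ℚ VK] (K : MixedHodgeStructure VK)
    {ι κ : Type w} [Fintype ι] [Fintype κ] (S : ι → SubMixedHodgeStructure H) (T : κ → SubMixedHodgeStructure H)
    (hS : iSupIndep fun i => (S i).toSubmodule) (hS' : (⨆ i, (S i).toSubmodule) = ⊤)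
    (hSi : ∀ i, (S i).toMixedHodgeStructure.IsIndecomposable)
    (hT : iSupIndep fun k => (T k).toSubmodule) (hT' : (⨆ k, (T k).toSubmodule) = ⊤)
    (hTi : ∀ k, (T k).toMixedHodgeStructure.IsIndecomposable) :
    (Finset.univ.filter fun i => ∃ e : Hom (S i).toMixedHodgeStructure K, Function.Bijective e.toLinearMap).card =
      (Finset.univ.filter fun k => ∃ e : Hom (T k).toMixedHodgeStructure K, Function.Bijective e.toLinearMap).card := by
  obtain ⟨σ, hσ⟩ := krullSchmidt_fintype S T hS hS' hSi hT hT' hTi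
  refine Finset.card_equiv σ fun i => ?_
  simp only [Finset.mem_filter, Finset.mem_univ, true_and]
  exact ⟨fun h => iso_trans (iso_symm (hσ i)) h, fun h => iso_trans (hσ i) h⟩

omit [FiniteDimensional ℚ V] in
open scoped Classical in
/-- The same across an isomorphism `H ⥲ H'`: isomorphic MHS have the same multiplicities.
[cite: Lam2001FirstCourse, Cor. (19.22), p. 288] -/
theorem card_filter_iso_eq_of_bijective {VK : Type u'} [AddCommGroup VK] [Module ℚ VK] (K : MixedHodgeStructure VK)
    (f : Hom H H') (hf : Function.Bijective f.toLinearMap)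
    {ι κ : Type w} [Fintype ι] [Fintype κ] (S : ι → SubMixedHodgeStructure H) (T : κ → SubMixedHodgeStructure H')
    (hS : iSupIndep fun i => (S i).toSubmodule) (hS' : (⨆ i, (S i).toSubmodule) = ⊤)
    (hSi : ∀ i, (S i).toMixedHodgeStructure.IsIndecomposable)
    (hT : iSupIndep fun k => (T k).toSubmodule) (hT' : (⨆ k, (T k).toSubmodule) = ⊤)
    (hTi : ∀ k, (T k).toMixedHodgeStructure.IsIndecomposable) :
    (Finset.univ.filter fun i => ∃ e : Hom (S i).toMixedHodgeStructure K, Function.Bijective e.toLinearMap).card =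
      (Finset.univ.filter fun k => ∃ e : Hom (T k).toMixedHodgeStructure K, Function.Bijective e.toLinearMap).card := by
  obtain ⟨σ, hσ⟩ := krullSchmidt_of_bijective f hf S T hS hS' hSi hT hT' hTi
  refine Finset.card_equiv σ fun i => ?_
  simp only [Finset.mem_filter, Finset.mem_univ, true_and]
  exact ⟨fun h => iso_trans (iso_symm (hσ i)) h, fun h => iso_trans (hσ i) h⟩

/-! ### §3 Assembling an isomorphism from isomorphisms of the summands -/

omit [FiniteDimensional ℚ V] [FiniteDimensional ℚ V'] in
/-- **Summand-wise isomorphisms glue**: if `H = ⊕ᵢ Sᵢ`, `H' = ⊕ₖ Tₖ` (independent spanning families of sub-MHS),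
`τ : ι ≃ κ` and `eᵢ : Sᵢ ⥲ T_{τ i}`, then `Σᵢ ι_{T_{τ i}} ∘ eᵢ ∘ αᵢ : H → H'` is an isomorphism of MHS.
[cite: Lam2001FirstCourse, Thm. (19.21), proof, p. 288] [cite: CattaniElZeinGriffithsLe2014, Thm. 3.2.18] -/
theorem exists_hom_bijective_of_forall_iso {ι : Type w} {κ : Type u'} [Fintype ι] [Fintype κ]
    (S : ι → SubMixedHodgeStructure H) (T : κ → SubMixedHodgeStructure H')
    (hS : iSupIndep fun i => (S i).toSubmodule) (hS' : (⨆ i, (S i).toSubmodule) = ⊤)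
    (hT : iSupIndep fun k => (T k).toSubmodule) (hT' : (⨆ k, (T k).toSubmodule) = ⊤) (τ : ι ≃ κ)
    (e : ∀ i, Hom (S i).toMixedHodgeStructure (T (τ i)).toMixedHodgeStructure)
    (he : ∀ i, Function.Bijective (e i).toLinearMap) :
    ∃ Φ : Hom H H', Function.Bijective Φ.toLinearMap := by
  classical
  let c : ι → Hom H H' := fun i => ((T (τ i)).subtype.comp (e i)).comp (proj S hS hS' i)
  obtain ⟨Φ, hΦ⟩ := Hom.exists_toLinearMap_eq_sum' Finset.univ c
  have hΦapply : ∀ x, Φ.toLinearMap x = ∑ i, (((e i).toLinearMap ((proj S hS hS' i).toLinearMap x)) : V') := fun x => by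
    rw [hΦ, LinearMap.sum_apply]; rfl
  -- `Φ` restricted to `S i` is `ι ∘ e i`
  have hΦS : ∀ i (x : ↥(S i).toSubmodule), Φ.toLinearMap x = (e i).toLinearMap x := fun i x => by
    rw [hΦapply, Finset.sum_eq_single i (fun j _ hji => by
      rw [proj_apply_of_mem_ne S hS hS' (Ne.symm hji) x.2, map_zero, Submodule.coe_zero])
      (fun h => absurd (Finset.mem_univ i) h), proj_apply_coe]
  -- the `T`-projection of `Φ x` onto `T (τ i)` is `e i (α_i x)`
  have hproj : ∀ i x, (proj T hT hT' (τ i)).toLinearMap (Φ.toLinearMap x) =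
      (e i).toLinearMap ((proj S hS hS' i).toLinearMap x) := fun i x => by
    rw [hΦapply, map_sum, Finset.sum_eq_single i (fun j _ hji => ?_) (fun h => absurd (Finset.mem_univ i) h),
      proj_apply_coe]
    exact proj_apply_of_mem_ne T hT hT' (fun h => hji (τ.injective h)) (Subtype.mem _)
  refine ⟨Φ, ?_, ?_⟩
  · -- injective: all `e i (α_i x)` vanish, hence all `α_i x`, hence `x = Σ α_i x = 0`
    rw [← LinearMap.ker_eq_bot, eq_bot_iff]
    intro x hx
    rw [LinearMap.mem_ker] at hx
    rw [Submodule.mem_bot, ← sum_coe_proj_apply S hS hS' x]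
    refine Finset.sum_eq_zero fun i _ => ?_
    have h0 : (e i).toLinearMap ((proj S hS hS' i).toLinearMap x) = 0 := by rw [← hproj, hx, map_zero]
    rw [← map_zero (e i).toLinearMap] at h0
    rw [(he i).1 h0, Submodule.coe_zero]
  · -- surjective: the range contains every `T k`
    rw [← LinearMap.range_eq_top, eq_top_iff, ← hT']
    refine iSup_le fun k => ?_
    obtain ⟨i, rfl⟩ := τ.surjective k
    intro y hy
    obtain ⟨x, hx⟩ := (he i).2 ⟨y, hy⟩
    refine ⟨(x : V), ?_⟩
    rw [hΦS i x, hx]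

/-! ### §4 The decomposition of `H ⊕ K` from a decomposition of `H` and the axis `0 ⊕ K` -/

section OptionFamily

omit [FiniteDimensional ℚ V] [FiniteDimensional ℚ V']

/-- Independence of the family `(Q, U₁, …, U_n)` when the `Uᵢ` are independent inside `P` and `P ⊓ Q = 0`
(submodule level). [cite: Lam2001FirstCourse, Thm. (19.21), proof, p. 288] -/
private theorem iSupIndep_optionElim_submodule {ι : Type w} {M : Type u'} [AddCommGroup M] [Module ℚ M]
    (P Q : Submodule ℚ M) (hPQ : Disjoint P Q) (U : ι → Submodule ℚ M) (hU : iSupIndep U) (hUP : ∀ i, U i ≤ P) :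
    iSupIndep fun o : Option ι => o.elim Q U := by
  refine iSupIndep_def.2 fun o => ?_
  cases o with
  | none =>
    -- `Q` against `⨆_{some i} U i ≤ P`
    refine hPQ.symm.mono_right (iSup₂_le fun o ho => ?_)
    cases o with
    | none => exact absurd rfl ho
    | some i => exact hUP i
  | some i =>
    -- `U i` against `Q ⊔ ⨆_{j ≠ i} U j`: modularity, `U i ≤ P`
    have hle : (⨆ (o : Option ι) (_ : o ≠ some i), o.elim Q U) ≤ Q ⊔ ⨆ (j) (_ : j ≠ i), U j := by
      refine iSup₂_le fun o ho => ?_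
      cases o with
      | none => exact le_sup_left
      | some j =>
        have hji : j ≠ i := fun h => ho (by rw [h])
        exact le_sup_of_le_right (le_iSup₂_of_le (f := fun j (_ : j ≠ i) => U j) j hji le_rfl)
    refine Disjoint.mono_right hle ?_
    rw [disjoint_iff, eq_bot_iff]
    intro x hx
    obtain ⟨hxU, hxQB⟩ := Submodule.mem_inf.1 hx
    have hxU' : x ∈ U i := hxU
    obtain ⟨q, hq, b, hb, rfl⟩ := Submodule.mem_sup.1 hxQB
    have hBP : (⨆ (j) (_ : j ≠ i), U j) ≤ P := iSup₂_le fun j _ => hUP j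
    -- `q = (q + b) - b ∈ P`, so `q ∈ P ⊓ Q = 0`
    have hqP : q ∈ P := by
      have h := P.sub_mem (hUP i hxU') (hBP hb)
      rwa [add_sub_cancel_right] at h
    have hq0 : q = 0 := by
      have h := Submodule.mem_inf.2 ⟨hqP, hq⟩
      rwa [hPQ.eq_bot, Submodule.mem_bot] at h
    rw [hq0, zero_add] at hxU' ⊢
    have h := Submodule.mem_inf.2 ⟨hxU', hb⟩
    rwa [(iSupIndep_def.1 hU i).eq_bot] at h

/-- The supremum of the family `(Q, U₁, …, U_n)` is `Q ⊔ ⨆ᵢ Uᵢ` (submodule level). [folklore] -/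
private theorem iSup_optionElim_submodule {ι : Type w} {M : Type u'} [AddCommGroup M] [Module ℚ M]
    (Q : Submodule ℚ M) (U : ι → Submodule ℚ M) : (⨆ o : Option ι, o.elim Q U) = Q ⊔ ⨆ i, U i := by
  refine le_antisymm (iSup_le fun o => ?_) (sup_le ?_ (iSup_le fun i => ?_))
  · cases o with
    | none => exact le_sup_left
    | some i => exact le_sup_of_le_right (le_iSup U i)
  · exact le_iSup (fun o : Option ι => o.elim Q U) none
  · exact le_iSup (fun o : Option ι => o.elim Q U) (some i)

variable {VK : Type u'} [AddCommGroup VK] [Module ℚ VK] {K : MixedHodgeStructure VK}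

/-- The family of sub-MHS of `H ⊕ K` consisting of the axis `0 ⊕ K` (index `none`) and the images `Sᵢ ⊕ 0` of a family
`(Sᵢ)` of sub-MHS of `H` (indices `some i`) is independent when `(Sᵢ)` is.
[cite: Lam2001FirstCourse, Thm. (19.21), proof, p. 288] -/
theorem iSupIndep_optionElim {ι : Type w} (S : ι → SubMixedHodgeStructure H)
    (hS : iSupIndep fun i => (S i).toSubmodule) :
    iSupIndep fun o : Option ι =>
      (o.elim (Hom.inr H K).range (fun i => (S i).map (Hom.inl H K)) : SubMixedHodgeStructure (H.prod K)).toSubmodule := by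
  have h := iSupIndep_optionElim_submodule (Hom.inl H K).range.toSubmodule (Hom.inr H K).range.toSubmodule
    (isCompl_range_inl_range_inr H K).disjoint (fun i => ((S i).map (Hom.inl H K)).toSubmodule)
    (iSupIndep_map_of_injective (Hom.inl H K) LinearMap.inl_injective hS)
    (fun i => by rw [map_toSubmodule, Hom.range_toSubmodule]; exact LinearMap.map_le_range)
  convert h using 1
  ext o
  cases o <;> rfl

/-- … and spans `H ⊕ K` when `(Sᵢ)` spans `H`. [cite: Lam2001FirstCourse, Thm. (19.21), proof, p. 288] -/
theorem iSup_optionElim_eq_top {ι : Type w} (S : ι → SubMixedHodgeStructure H) (hS' : (⨆ i, (S i).toSubmodule) = ⊤) :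
    (⨆ o : Option ι, (o.elim (Hom.inr H K).range (fun i => (S i).map (Hom.inl H K)) :
      SubMixedHodgeStructure (H.prod K)).toSubmodule) = ⊤ := by
  have h := iSup_optionElim_submodule (Hom.inr H K).range.toSubmodule (fun i => ((S i).map (Hom.inl H K)).toSubmodule)
  have h' : (⨆ o : Option ι, (o.elim (Hom.inr H K).range (fun i => (S i).map (Hom.inl H K)) :
      SubMixedHodgeStructure (H.prod K)).toSubmodule) =
      ⨆ o : Option ι, o.elim (Hom.inr H K).range.toSubmodule (fun i => ((S i).map (Hom.inl H K)).toSubmodule) :=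
    iSup_congr fun o => by cases o <;> rfl
  rw [h', h]
  simp only [map_toSubmodule]
  rw [← Submodule.map_iSup, hS', Submodule.map_top, Hom.range_toSubmodule, sup_comm]
  exact (isCompl_range_inl_range_inr H K).sup_eq_top

/-- … and consists of indecomposable sub-MHS when the `Sᵢ` and `K` are indecomposable.
[cite: Lam2001FirstCourse, Thm. (19.21), proof, p. 288] -/
theorem isIndecomposable_optionElim {ι : Type w} (S : ι → SubMixedHodgeStructure H)
    (hSi : ∀ i, (S i).toMixedHodgeStructure.IsIndecomposable) (hK : K.IsIndecomposable) (o : Option ι) :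
    ((o.elim (Hom.inr H K).range (fun i => (S i).map (Hom.inl H K)) :
      SubMixedHodgeStructure (H.prod K)).toMixedHodgeStructure).IsIndecomposable := by
  cases o with
  | none => exact hK.of_bijective _ ((Hom.inr H K).rangeRestrict_bijective_of_injective LinearMap.inr_injective)
  | some i => exact isIndecomposable_map_of_injective (Hom.inl H K) LinearMap.inl_injective (hSi i)

/-- The axis `0 ⊕ K` is isomorphic to `K`. [cite: CattaniElZeinGriffithsLe2014, Lemma 3.2.20] -/
theorem exists_iso_range_inr (H : MixedHodgeStructure V) (K : MixedHodgeStructure VK) :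
    ∃ e : Hom K (Hom.inr H K).range.toMixedHodgeStructure, Function.Bijective e.toLinearMap :=
  ⟨_, (Hom.inr H K).rangeRestrict_bijective_of_injective LinearMap.inr_injective⟩

/-- The piece `Sᵢ ⊕ 0` is isomorphic to `Sᵢ`. [cite: CattaniElZeinGriffithsLe2014, Lemma 3.2.20] -/
theorem exists_iso_map_inl (S : SubMixedHodgeStructure H) (K : MixedHodgeStructure VK) :
    ∃ e : Hom S.toMixedHodgeStructure (S.map (Hom.inl H K)).toMixedHodgeStructure, Function.Bijective e.toLinearMap :=
  ⟨_, bijective_restrictHom_map (Hom.inl H K) LinearMap.inl_injective S⟩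

end OptionFamily

/-! ### §5 Cancellation -/

section Cancellation

variable {V₂ : Type v} [AddCommGroup V₂] [Module ℚ V₂] [FiniteDimensional ℚ V₂] {H₂ : MixedHodgeStructure V₂}
variable {VK : Type u'} [AddCommGroup VK] [Module ℚ VK] [FiniteDimensional ℚ VK] {K : MixedHodgeStructure VK}

/-- **Cancellation of an indecomposable summand**: `H ⊕ K ≅ H₂ ⊕ K` with `K` indecomposable implies `H ≅ H₂`.
Decompose `H = ⊕ Sᵢ`, `H₂ = ⊕ S'ⱼ`; then `H ⊕ K` and `H₂ ⊕ K` carry decompositions indexed by `Option _` (the axis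
`0 ⊕ K` at `none`), Krull–Schmidt across the isomorphism gives `σ : Option (Fin n) ≃ Option (Fin n₂)` with
isomorphic pieces, and `Equiv.removeNone σ` matches the `Sᵢ` with the `S'ⱼ` up to isomorphism (through `K` when
`σ` moves the axis); the summand-wise isomorphisms glue. (Lam (20.11): modules with local — more generally
semilocal — endomorphism ring cancel from direct sums; here via (19.21).)
[cite: Lam2001FirstCourse, Thm. (20.11), p. 299] [cite: Lam2001FirstCourse, Thm. (19.21), pp. 287–288] -/
theorem exists_hom_bijective_of_prod_of_isIndecomposable (hK : K.IsIndecomposable) (f : Hom (H.prod K) (H₂.prod K))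
    (hf : Function.Bijective f.toLinearMap) : ∃ e : Hom H H₂, Function.Bijective e.toLinearMap := by
  classical
  obtain ⟨n, S, hS, hS', hSi⟩ := exists_iSupIndep_isIndecomposable H
  obtain ⟨n₂, S₂, hS₂, hS₂', hS₂i⟩ := exists_iSupIndep_isIndecomposable H₂
  -- the two `Option`-indexed decompositions of `H ⊕ K` and `H₂ ⊕ K`
  let X : Option (Fin n) → SubMixedHodgeStructure (H.prod K) :=
    fun o => o.elim (Hom.inr H K).range (fun i => (S i).map (Hom.inl H K))
  let Y : Option (Fin n₂) → SubMixedHodgeStructure (H₂.prod K) :=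
    fun o => o.elim (Hom.inr H₂ K).range (fun i => (S₂ i).map (Hom.inl H₂ K))
  obtain ⟨σ, hσ⟩ := krullSchmidt_of_bijective f hf X Y (iSupIndep_optionElim S hS) (iSup_optionElim_eq_top S hS')
    (isIndecomposable_optionElim S hSi hK) (iSupIndep_optionElim S₂ hS₂) (iSup_optionElim_eq_top S₂ hS₂')
    (isIndecomposable_optionElim S₂ hS₂i hK)
  -- isomorphism types of the pieces
  have hXs : ∀ i, ∃ e : Hom (S i).toMixedHodgeStructure (X (some i)).toMixedHodgeStructure,
      Function.Bijective e.toLinearMap := fun i => exists_iso_map_inl (S i) K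
  have hXn : ∃ e : Hom K (X none).toMixedHodgeStructure, Function.Bijective e.toLinearMap := exists_iso_range_inr H K
  have hYs : ∀ j, ∃ e : Hom (S₂ j).toMixedHodgeStructure (Y (some j)).toMixedHodgeStructure,
      Function.Bijective e.toLinearMap := fun j => exists_iso_map_inl (S₂ j) K
  have hYn : ∃ e : Hom K (Y none).toMixedHodgeStructure, Function.Bijective e.toLinearMap := exists_iso_range_inr H₂ K
  -- `τ = removeNone σ` matches `S i` with `S₂ (τ i)`
  let τ : Fin n ≃ Fin n₂ := Equiv.removeNone σ
  have hτ : ∀ i, ∃ e : Hom (S i).toMixedHodgeStructure (S₂ (τ i)).toMixedHodgeStructure,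
      Function.Bijective e.toLinearMap := by
    intro i
    rcases hσi : σ (some i) with _ | j
    · -- `σ` moves `S i ⊕ 0` to the axis: `S i ≅ K ≅ X none ≅ Y (σ none) = Y (some (τ i)) ≅ S₂ (τ i)`
      have h1 : some (τ i) = σ none := Equiv.removeNone_none σ hσi
      have hSiK : ∃ e : Hom (S i).toMixedHodgeStructure K, Function.Bijective e.toLinearMap :=
        iso_trans (iso_trans (hXs i) (hσi ▸ hσ (some i))) (iso_symm hYn)
      have hKS₂ : ∃ e : Hom K (S₂ (τ i)).toMixedHodgeStructure, Function.Bijective e.toLinearMap :=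
        iso_trans (iso_trans hXn (hσ none)) (h1 ▸ iso_symm (hYs (τ i)))
      exact iso_trans hSiK hKS₂
    · -- `σ (some i) = some j` with `j = τ i`: `S i ≅ X (some i) ≅ Y (some j) ≅ S₂ j`
      have h1 : some (τ i) = σ (some i) := Equiv.removeNone_some σ ⟨j, hσi⟩
      rw [hσi, Option.some.injEq] at h1
      rw [h1]
      exact iso_trans (iso_trans (hXs i) (hσi ▸ hσ (some i))) (iso_symm (hYs j))
  choose e he using hτ
  exact exists_hom_bijective_of_forall_iso S S₂ hS hS' hS₂ hS₂' τ e he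

omit [FiniteDimensional ℚ V] in
/-- The re-bracketing isomorphism `H ⊕ (A ⊕ B) ⥲ (H ⊕ B) ⊕ A`. [folklore] -/
private theorem exists_rebracket {VA : Type w} [AddCommGroup VA] [Module ℚ VA] {VB : Type u'} [AddCommGroup VB]
    [Module ℚ VB] (G : MixedHodgeStructure V) (A : MixedHodgeStructure VA) (B : MixedHodgeStructure VB) :
    ∃ e : Hom (G.prod (A.prod B)) ((G.prod B).prod A), Function.Bijective e.toLinearMap := by
  refine ⟨Hom.prodLift (Hom.prodLift (Hom.fst G (A.prod B)) ((Hom.snd A B).comp (Hom.snd G (A.prod B))))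
    ((Hom.fst A B).comp (Hom.snd G (A.prod B))), fun x y hxy => ?_, fun y => ?_⟩
  · have h1 := congrArg (fun z => z.1.1) hxy
    have h2 := congrArg (fun z => z.1.2) hxy
    have h3 := congrArg (fun z => z.2) hxy
    exact Prod.ext h1 (Prod.ext h3 h2)
  · exact ⟨(y.1.1, (y.2, y.1.2)), rfl⟩

omit [FiniteDimensional ℚ V] in
/-- `H ⊕ K ≅ H ⊕ K'` for `K ≅ K'`. [folklore] -/
private theorem exists_prod_congr_right {VA : Type w} [AddCommGroup VA] [Module ℚ VA] {VB : Type u'} [AddCommGroup VB]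
    [Module ℚ VB] (G : MixedHodgeStructure V) {A : MixedHodgeStructure VA} {B : MixedHodgeStructure VB} (g : Hom A B)
    (hg : Function.Bijective g.toLinearMap) :
    ∃ e : Hom (G.prod A) (G.prod B), Function.Bijective e.toLinearMap := by
  refine ⟨Hom.prodLift (Hom.fst G A) (g.comp (Hom.snd G A)), fun x y hxy => ?_, fun y => ?_⟩
  · have h1 := congrArg (fun z => z.1) hxy
    have h2 := congrArg (fun z => z.2) hxy
    exact Prod.ext h1 (hg.1 h2)
  · obtain ⟨a, ha⟩ := hg.2 y.2
    exact ⟨(y.1, a), Prod.ext rfl ha⟩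

omit [FiniteDimensional ℚ VK] in
/-- A sub-MHS decomposition `K = K₁ ⊕ K'` yields an isomorphism `K₁ ⊕ K' ⥲ K` (external to internal direct sum).
[cite: CattaniElZeinGriffithsLe2014, Thm. 3.2.18] -/
theorem bijective_coprodDesc_subtype_of_isCompl (K₁ K' : SubMixedHodgeStructure K)
    (h : IsCompl K₁.toSubmodule K'.toSubmodule) :
    Function.Bijective (Hom.coprodDesc K₁.subtype K'.subtype).toLinearMap :=
  (Submodule.prodEquivOfIsCompl _ _ h).bijective

/-- The auxiliary induction on `dim K`. [cite: Lam2001FirstCourse, Thm. (20.11), p. 299] -/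
private theorem cancel_aux (d : ℕ) : ∀ {W : Type u'} [AddCommGroup W] [Module ℚ W] [FiniteDimensional ℚ W]
    (L : MixedHodgeStructure W), finrank ℚ W ≤ d → ∀ (f : Hom (H.prod L) (H₂.prod L)),
    Function.Bijective f.toLinearMap → ∃ e : Hom H H₂, Function.Bijective e.toLinearMap := by
  induction d with
  | zero =>
    intro W _ _ _ L hd f hf
    haveI : Subsingleton W := finrank_zero_iff.1 (Nat.le_zero.1 hd)
    -- `H ≅ H ⊕ 0 ≅ H₂ ⊕ 0 ≅ H₂`
    refine ⟨(Hom.fst H₂ L).comp (f.comp (Hom.inl H L)), fun x y hxy => ?_, fun y => ?_⟩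
    · have h : f.toLinearMap (x, 0) = f.toLinearMap (y, 0) :=
        Prod.ext hxy (Subsingleton.elim _ _)
      exact congrArg Prod.fst (hf.1 h)
    · obtain ⟨x, hx⟩ := hf.2 (y, 0)
      refine ⟨x.1, ?_⟩
      have hx0 : x = (x.1, 0) := Prod.ext rfl (Subsingleton.elim _ _)
      change (f.toLinearMap ((x.1, (0 : W)))).1 = y
      rw [← hx0, hx]
  | succ d ih =>
    intro W _ _ _ L hd f hf
    by_cases hW : Subsingleton W
    · exact ih L (by rw [finrank_zero_of_subsingleton]; exact Nat.zero_le _) f hf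
    rw [not_subsingleton_iff_nontrivial] at hW
    -- split off an indecomposable summand `K₁` of `L`: `L = K₁ ⊕ K'`
    obtain ⟨K₁, K', hc, hK₁⟩ := exists_isCompl_isIndecomposable L
    haveI := hK₁.nontrivial
    obtain ⟨ψ, hψ⟩ : ∃ e : Hom L (K₁.toMixedHodgeStructure.prod K'.toMixedHodgeStructure),
        Function.Bijective e.toLinearMap :=
      iso_symm ⟨_, bijective_coprodDesc_subtype_of_isCompl K₁ K' hc⟩
    -- `(H ⊕ K') ⊕ K₁ ≅ H ⊕ L ≅ H₂ ⊕ L ≅ (H₂ ⊕ K') ⊕ K₁`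
    have h1 : ∃ e : Hom ((H.prod K'.toMixedHodgeStructure).prod K₁.toMixedHodgeStructure)
        ((H₂.prod K'.toMixedHodgeStructure).prod K₁.toMixedHodgeStructure), Function.Bijective e.toLinearMap :=
      iso_trans (iso_trans (iso_trans (iso_symm (exists_rebracket H _ _)) (iso_symm (exists_prod_congr_right H ψ hψ)))
        ⟨f, hf⟩) (iso_trans (exists_prod_congr_right H₂ ψ hψ) (exists_rebracket H₂ _ _))
    obtain ⟨f₁, hf₁⟩ := h1
    -- cancel the indecomposable `K₁`, then `K'` by induction (`dim K' < dim L`)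
    obtain ⟨f', hf'⟩ := exists_hom_bijective_of_prod_of_isIndecomposable hK₁ f₁ hf₁
    have hK' : finrank ℚ K'.toSubmodule ≤ d := by
      have h1 := Submodule.finrank_add_eq_of_isCompl hc
      have h2 : 0 < finrank ℚ K₁.toSubmodule := finrank_pos
      omega
    exact ih K'.toMixedHodgeStructure hK' f' hf'

/-- **Cancellation for mixed Hodge structures**: `H ⊕ K ≅ H₂ ⊕ K` implies `H ≅ H₂`, for every MHS `K` (every MHS is a
finite direct sum of indecomposables, which cancel one at a time). Lam (20.11) / Facchini Cor. 4.6: a summand with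
semilocal endomorphism ring cancels; `End_MHS(K)` is a finite-dimensional `ℚ`-algebra, hence semilocal — here the
proof runs through the Krull–Schmidt theorem instead. [cite: Lam2001FirstCourse, Thm. (20.11), p. 299]
[cite: Lam2001FirstCourse, Thm. (19.21), pp. 287–288] -/
theorem exists_hom_bijective_of_prod (f : Hom (H.prod K) (H₂.prod K)) (hf : Function.Bijective f.toLinearMap) :
    ∃ e : Hom H H₂, Function.Bijective e.toLinearMap :=
  cancel_aux (finrank ℚ VK) K le_rfl f hf

/-- The swap `A ⊕ B ⥲ B ⊕ A` is bijective. [folklore] -/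
private theorem bij_prodSwap {VA : Type*} [AddCommGroup VA] [Module ℚ VA] {VB : Type*} [AddCommGroup VB]
    [Module ℚ VB] (A : MixedHodgeStructure VA) (B : MixedHodgeStructure VB) :
    Function.Bijective (Hom.prodLift (Hom.snd A B) (Hom.fst A B)).toLinearMap :=
  ⟨fun _ _ hxy => Prod.ext (congrArg Prod.snd hxy) (congrArg Prod.fst hxy), fun y => ⟨(y.2, y.1), rfl⟩⟩

/-- Cancellation on the left: `K ⊕ H ≅ K ⊕ H₂` implies `H ≅ H₂`. [cite: Lam2001FirstCourse, Thm. (20.11), p. 299] -/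
theorem exists_hom_bijective_of_prod_left (f : Hom (K.prod H) (K.prod H₂)) (hf : Function.Bijective f.toLinearMap) :
    ∃ e : Hom H H₂, Function.Bijective e.toLinearMap :=
  -- swap the factors: `H ⊕ K ≅ K ⊕ H ≅ K ⊕ H₂ ≅ H₂ ⊕ K`
  exists_hom_bijective_of_prod (K := K)
    (((Hom.prodLift (Hom.snd K H₂) (Hom.fst K H₂)).comp f).comp (Hom.prodLift (Hom.snd H K) (Hom.fst H K)))
    (bij_comp _ _ (bij_comp _ _ (bij_prodSwap K H₂) hf) (bij_prodSwap H K))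

end Cancellation

end MixedHodgeStructure

end Literature.AlgebraicGeometry.Motives
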